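import Mathlib
import HarnessLib

/-!
# Negative moments from small-ball bounds

Elementary measure-theoretic facts behind "delocalisation" estimates for ratio singularities
`X = A / D` under a weighted law `w dμ` (`w ≥ 0`, `Z = ∫ w dμ`), all stated so that they can be fed
literally with hypotheses of the form `∫ 1{A ≤ ε M} w dμ ≤ K ε^c Z`:

* `lintegral_rpow_neg_mul_le_of_smallBalls` (layer cake): a polynomial small-ball bound at a scale
  `M > 0`, `∫ 1{A ≤ ε M} w dμ ≤ K ε^c Z` for every `ε > 0`, gives for `0 < r < c` the negative-moment
  bound `∫⁻ (ofReal A)^{-r} · ofReal w dμ ≤ (1 + K r/(c-r)) M^{-r} Z` in `ℝ≥0∞` (where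
  `(ofReal 0)^{-r} = ⊤`: the small balls force `A > 0` almost everywhere for `w dμ`).  Proof: the
  tail formula `∫ Y dν = ∫₀^∞ ν{Y ≥ t} dt` for `Y = A^{-r}`, the trivial bound `ν ≤ Z` on `t ≤ M^{-r}`
  and the small balls `ν{A^{-r} ≥ t} ≤ ν{A ≤ t^{-1/r}} ≤ K Z M^{-c} t^{-c/r}` on `t > M^{-r}`.
* `pow_mul_prod_mul_integral_le_of_smallBalls` (reverse Hölder by a union bound): if finitely many
  amplitudes `F_i ≥ 0` have joint small-ball mass `Σ_i ∫ 1{F_i ≤ ε M_i} w dμ ≤ Z/2`, then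
  `ε^n (∏ M_i) Z ≤ 2 ∫ (∏ F_i) w dμ` (on the good set every `F_i > ε M_i`, and it carries half of
  the mass).
* `ofReal_mul_ofReal_div_rpow_neg` (a positive denominator moves out of a negative power in
  `ℝ≥0∞`, junk-free): `ofReal F · ofReal (A/D)^{-r} = ofReal (F D^r) · (ofReal A)^{-r}`.

Standard material: the layer-cake (Cavalieri) representation of moments and the union bound; no
named source is followed. [folklore]
-/

namespace Literature.MeasureTheory.Integral

open _root_.MeasureTheory _root_.Set _root_.Filter
open scoped BigOperators ENNReal Topology

/-- The weighted indicator `1{p} · w` is the set indicator of `{p}` applied to `w`. [folklore] -/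
theorem ite_one_zero_mul_eq_indicator {X : Type*} (p : X → Prop) [DecidablePred p] (w : X → ℝ) :
    (fun x => (if p x then (1 : ℝ) else 0) * w x) = Set.indicator {x | p x} w := by
  funext x
  by_cases hx : p x
  · simp [hx]
  · simp [hx]

/-- **Negative moments from small balls (layer cake).** Let `A, w ≥ 0` be measurable, `w` integrable,
`Z = ∫ w dμ`, and suppose the small-ball bound `∫ 1{A ≤ ε M} w dμ ≤ K ε^c Z` at some scale `M > 0` for
every `ε > 0`.  Then for `0 < r < c`,
`∫⁻ (ofReal A)^{-r} ofReal w dμ ≤ ofReal ((1 + K · r/(c-r)) · M^{-r} · Z)`. [folklore] -/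
theorem lintegral_rpow_neg_mul_le_of_smallBalls {X : Type*} [MeasurableSpace X] (μ : Measure X)
    {A w : X → ℝ} (hA : Measurable A) (hw : Measurable w) (hA0 : ∀ x, 0 ≤ A x)
    (hw0 : ∀ x, 0 ≤ w x) (hwi : Integrable w μ) {M K c r : ℝ} (hM : 0 < M) (hK : 0 ≤ K)
    (hr : 0 < r) (hrc : r < c)
    (hsb : ∀ ε : ℝ, 0 < ε →
      ∫ x, (if A x ≤ ε * M then (1 : ℝ) else 0) * w x ∂μ ≤ K * ε ^ c * ∫ x, w x ∂μ) :
    ∫⁻ x, ENNReal.ofReal (A x) ^ (-r) * ENNReal.ofReal (w x) ∂μ ≤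
      ENNReal.ofReal ((1 + K * (r / (c - r))) * M ^ (-r) * ∫ x, w x ∂μ) := by
  set Z : ℝ := ∫ x, w x ∂μ with hZdef
  have hZ0 : 0 ≤ Z := integral_nonneg hw0
  have hc : 0 < c := hr.trans hrc
  have hr0 : r ≠ 0 := hr.ne'
  have hcr0 : 0 < c - r := sub_pos.2 hrc
  set ν : Measure X := μ.withDensity fun x => ENNReal.ofReal (w x) with hν
  have hwm : Measurable fun x => ENNReal.ofReal (w x) := hw.ennreal_ofReal
  -- weighted masses of measurable sets are real integrals
  have hνapp : ∀ {s : Set X}, MeasurableSet s → ν s = ENNReal.ofReal (∫ x in s, w x ∂μ) := by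
    intro s hs
    rw [hν, withDensity_apply _ hs,
      ofReal_integral_eq_lintegral_ofReal hwi.integrableOn (ae_of_all _ fun x => hw0 x)]
  have hνuniv : ν univ = ENNReal.ofReal Z := by
    rw [hνapp MeasurableSet.univ, Measure.restrict_univ]
  -- the small balls, for `ν`
  have hball : ∀ ε : ℝ, 0 < ε → ν {x | A x ≤ ε * M} ≤ ENNReal.ofReal (K * ε ^ c * Z) := by
    intro ε hε
    have hs : MeasurableSet {x | A x ≤ ε * M} := measurableSet_le hA measurable_const
    calc ν {x | A x ≤ ε * M}
        = ENNReal.ofReal (∫ x, (if A x ≤ ε * M then (1 : ℝ) else 0) * w x ∂μ) := by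
          rw [hνapp hs, ite_one_zero_mul_eq_indicator, integral_indicator hs]
      _ ≤ ENNReal.ofReal (K * ε ^ c * Z) := ENNReal.ofReal_le_ofReal (hsb ε hε)
  -- hence `A > 0` almost everywhere for `ν`
  have hpos : ∀ᵐ x ∂ν, 0 < A x := by
    rw [ae_iff]
    have hle : ∀ ε : ℝ, 0 < ε → ν {x | ¬0 < A x} ≤ ENNReal.ofReal (K * ε ^ c * Z) := fun ε hε =>
      (measure_mono fun x (hx : ¬0 < A x) => (not_lt.1 hx).trans (by positivity)).trans (hball ε hε)
    have ht : Tendsto (fun ε : ℝ => ENNReal.ofReal (K * ε ^ c * Z)) (𝓝 0) (𝓝 0) := by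
      have h := ENNReal.tendsto_ofReal
        (((Real.continuousAt_rpow_const 0 c (Or.inr hc.le)).tendsto.const_mul K).mul_const Z)
      rwa [Real.zero_rpow hc.ne', mul_zero, zero_mul, ENNReal.ofReal_zero] at h
    exact le_antisymm (ge_of_tendsto (ht.mono_left (nhdsWithin_le_nhds (s := Ioi 0)))
      (eventually_nhdsWithin_of_forall fun ε (hε : 0 < ε) => hle ε hε)) zero_le
  -- pass to `ν` and apply the layer-cake formula to `A ^ (-r)`
  have hAr : Measurable fun x => A x ^ (-r) := hA.pow_const _
  have hg : Measurable fun x => ENNReal.ofReal (A x) ^ (-r) := hA.ennreal_ofReal.pow_const _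
  have h1 : ∫⁻ x, ENNReal.ofReal (A x) ^ (-r) * ENNReal.ofReal (w x) ∂μ =
      ∫⁻ x, ENNReal.ofReal (A x) ^ (-r) ∂ν := by
    rw [hν, lintegral_withDensity_eq_lintegral_mul _ hwm hg]
    exact lintegral_congr fun x => by rw [Pi.mul_apply, mul_comm]
  have h2 : ∫⁻ x, ENNReal.ofReal (A x) ^ (-r) ∂ν = ∫⁻ x, ENNReal.ofReal (A x ^ (-r)) ∂ν :=
    lintegral_congr_ae (hpos.mono fun x hx => ENNReal.ofReal_rpow_of_pos hx)
  rw [h1, h2, lintegral_eq_lintegral_meas_le ν (ae_of_all _ fun x => Real.rpow_nonneg (hA0 x) _)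
    hAr.aemeasurable]
  -- the tail bound at every level `t > 0`
  have htail : ∀ t : ℝ, 0 < t →
      ν {x | t ≤ A x ^ (-r)} ≤ ENNReal.ofReal (K * Z * M ^ (-c) * t ^ (-(c / r))) := by
    intro t ht
    set ε : ℝ := t ^ (-(1 / r)) / M with hε
    have hε0 : 0 < ε := div_pos (Real.rpow_pos_of_pos ht _) hM
    have hsub : {x | t ≤ A x ^ (-r)} ⊆ {x | A x ≤ ε * M} := by
      intro x hx
      have hx : t ≤ A x ^ (-r) := hx
      show A x ≤ ε * M
      rw [hε, div_mul_cancel₀ _ hM.ne']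
      have hAx : 0 < A x := by
        by_contra h0
        rw [le_antisymm (not_lt.1 h0) (hA0 x), Real.zero_rpow (neg_ne_zero.2 hr0)] at hx
        exact absurd hx (not_le.2 ht)
      calc A x = A x ^ ((-r) * (-(1 / r))) := by
            rw [show (-r) * (-(1 / r)) = 1 by field_simp, Real.rpow_one]
        _ = (A x ^ (-r)) ^ (-(1 / r)) := Real.rpow_mul hAx.le _ _
        _ ≤ t ^ (-(1 / r)) :=
            Real.rpow_le_rpow_of_nonpos ht hx (neg_nonpos.2 (by positivity))
    calc ν {x | t ≤ A x ^ (-r)} ≤ ν {x | A x ≤ ε * M} := measure_mono hsub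
      _ ≤ ENNReal.ofReal (K * ε ^ c * Z) := hball ε hε0
      _ = ENNReal.ofReal (K * Z * M ^ (-c) * t ^ (-(c / r))) := by
          congr 1
          rw [hε, Real.div_rpow (Real.rpow_nonneg ht.le _) hM.le, ← Real.rpow_mul ht.le,
            show -(1 / r) * c = -(c / r) by ring, Real.rpow_neg hM.le c, div_eq_mul_inv]
          ring
  -- split the level integral at `T = M ^ (-r)`
  set T : ℝ := M ^ (-r) with hT
  have hT0 : 0 < T := Real.rpow_pos_of_pos hM _
  rw [← Ioc_union_Ioi_eq_Ioi hT0.le]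
  refine (lintegral_union_le _ _ _).trans ?_
  have hp1 : ∫⁻ t in Ioc 0 T, ν {x | t ≤ A x ^ (-r)} ≤ ENNReal.ofReal (Z * T) :=
    calc ∫⁻ t in Ioc 0 T, ν {x | t ≤ A x ^ (-r)} ≤ ∫⁻ _ in Ioc 0 T, ENNReal.ofReal Z :=
          lintegral_mono fun t => (measure_mono (subset_univ _)).trans hνuniv.le
      _ = ENNReal.ofReal (Z * T) := by
          rw [setLIntegral_const, Real.volume_Ioc, sub_zero, ← ENNReal.ofReal_mul hZ0]
  have hexp : -(c / r) < -1 := by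
    rw [neg_lt_neg_iff, one_lt_div hr]
    exact hrc
  have hint : IntegrableOn (fun t : ℝ => K * Z * M ^ (-c) * t ^ (-(c / r))) (Ioi T) :=
    (integrableOn_Ioi_rpow_of_lt hexp hT0).const_mul _
  have hp2 : ∫⁻ t in Ioi T, ν {x | t ≤ A x ^ (-r)} ≤
      ENNReal.ofReal (K * (r / (c - r)) * M ^ (-r) * Z) :=
    calc ∫⁻ t in Ioi T, ν {x | t ≤ A x ^ (-r)}
        ≤ ∫⁻ t in Ioi T, ENNReal.ofReal (K * Z * M ^ (-c) * t ^ (-(c / r))) :=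
          setLIntegral_mono' measurableSet_Ioi fun t ht => htail t (hT0.trans ht)
      _ = ENNReal.ofReal (∫ t in Ioi T, K * Z * M ^ (-c) * t ^ (-(c / r))) :=
          (ofReal_integral_eq_lintegral_ofReal hint ((ae_restrict_mem measurableSet_Ioi).mono
            fun t ht => by
              have ht' : 0 < t := hT0.trans ht
              positivity)).symm
      _ = ENNReal.ofReal (K * (r / (c - r)) * M ^ (-r) * Z) := by
          congr 1
          have hcr1 : c - r ≠ 0 := hcr0.ne'
          have hu : M ^ c ≠ 0 := (Real.rpow_pos_of_pos hM c).ne'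
          have he1 : -r * (-(c / r) + 1) = c + -r := by
            rw [mul_add, mul_neg, mul_one, neg_mul, neg_neg, mul_div_cancel₀ c hr0]
          rw [integral_const_mul, integral_Ioi_rpow_of_lt hexp hT0, hT, ← Real.rpow_mul hM.le, he1,
            Real.rpow_add hM, Real.rpow_neg hM.le c,
            show -(c / r) + 1 = -((c - r) / r) by rw [sub_div, div_self hr0]; ring]
          field_simp
  calc (∫⁻ t in Ioc 0 T, ν {x | t ≤ A x ^ (-r)}) + ∫⁻ t in Ioi T, ν {x | t ≤ A x ^ (-r)}
      ≤ ENNReal.ofReal (Z * T) + ENNReal.ofReal (K * (r / (c - r)) * M ^ (-r) * Z) :=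
        add_le_add hp1 hp2
    _ = ENNReal.ofReal ((1 + K * (r / (c - r))) * M ^ (-r) * Z) := by
        rw [← ENNReal.ofReal_add (by positivity) (by positivity), hT]
        congr 1
        ring

/-- **Reverse Hölder from joint small balls (union bound).** For finitely many measurable amplitudes
`F_i ≥ 0`, a weight `w ≥ 0` and scales `M_i ≥ 0`, `ε ≥ 0`: if
`Σ_i ∫ 1{F_i ≤ ε M_i} w dμ ≤ ½ ∫ w dμ`, then `ε^n (∏_i M_i) ∫ w dμ ≤ 2 ∫ (∏_i F_i) w dμ`
(`n` the number of indices). [folklore] -/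
theorem pow_mul_prod_mul_integral_le_of_smallBalls {X : Type*} [MeasurableSpace X] (μ : Measure X)
    {ι : Type*} [Fintype ι] {F : ι → X → ℝ} {w : X → ℝ} {M : ι → ℝ} {ε : ℝ}
    (hF : ∀ i, Measurable (F i)) (hF0 : ∀ i x, 0 ≤ F i x) (hw0 : ∀ x, 0 ≤ w x)
    (hwi : Integrable w μ) (hFwi : Integrable (fun x => (∏ i, F i x) * w x) μ)
    (hM : ∀ i, 0 ≤ M i) (hε : 0 ≤ ε)
    (hsb : ∑ i, ∫ x, (if F i x ≤ ε * M i then (1 : ℝ) else 0) * w x ∂μ ≤ (1 / 2) * ∫ x, w x ∂μ) :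
    ε ^ Fintype.card ι * (∏ i, M i) * ∫ x, w x ∂μ ≤ 2 * ∫ x, (∏ i, F i x) * w x ∂μ := by
  obtain ⟨ind, hind⟩ : ∃ ind : ι → X → ℝ, ∀ i x, ind i x = if F i x ≤ ε * M i then (1 : ℝ) else 0 :=
    ⟨_, fun _ _ => rfl⟩
  simp only [← hind] at hsb
  set P : ℝ := ε ^ Fintype.card ι * ∏ i, M i with hPdef
  have hP0 : 0 ≤ P := mul_nonneg (pow_nonneg hε _) (Finset.prod_nonneg fun i _ => hM i)
  have hP : P = ∏ i, ε * M i := by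
    rw [Finset.prod_mul_distrib, Finset.prod_const, Finset.card_univ]
  have hind0 : ∀ i x, 0 ≤ ind i x := fun i x => by rw [hind]; positivity
  -- pointwise domination of `P (1 - Σ_i 1{F_i ≤ ε M_i}) w` by `(∏ F_i) w`
  have hpt : ∀ x, P * ((1 - ∑ i, ind i x) * w x) ≤ (∏ i, F i x) * w x := by
    intro x
    by_cases hx : ∀ i, ε * M i < F i x
    · have h0 : ∑ i, ind i x = 0 :=
        Finset.sum_eq_zero fun i _ => by rw [hind]; exact if_neg (not_le.2 (hx i))
      rw [h0, sub_zero, one_mul, hP]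
      exact mul_le_mul_of_nonneg_right
        (Finset.prod_le_prod (fun i _ => mul_nonneg hε (hM i)) fun i _ => (hx i).le) (hw0 x)
    · push Not at hx
      obtain ⟨i, hi⟩ := hx
      have h1 : (1 : ℝ) ≤ ∑ j, ind j x :=
        calc (1 : ℝ) = ind i x := by rw [hind, if_pos hi]
          _ ≤ ∑ j, ind j x := Finset.single_le_sum (fun j _ => hind0 j x) (Finset.mem_univ i)
      calc P * ((1 - ∑ j, ind j x) * w x) ≤ 0 :=
            mul_nonpos_of_nonneg_of_nonpos hP0
              (mul_nonpos_of_nonpos_of_nonneg (by linarith) (hw0 x))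
        _ ≤ (∏ j, F j x) * w x := mul_nonneg (Finset.prod_nonneg fun j _ => hF0 j x) (hw0 x)
  -- integrate
  have hindi : ∀ i, Integrable (fun x => ind i x * w x) μ := fun i => by
    rw [show (fun x => ind i x * w x) = fun x => (if F i x ≤ ε * M i then (1 : ℝ) else 0) * w x from
      funext fun x => by rw [hind], ite_one_zero_mul_eq_indicator]
    exact hwi.indicator (measurableSet_le (hF i) measurable_const)
  have hsum : Integrable (fun x => ∑ i, ind i x * w x) μ := integrable_finsetSum _ fun i _ => hindi i
  have heq : (fun x => (1 - ∑ i, ind i x) * w x) = fun x => w x - ∑ i, ind i x * w x := by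
    funext x
    rw [sub_mul, one_mul, Finset.sum_mul]
  have hmin : Integrable (fun x => (1 - ∑ i, ind i x) * w x) μ := by
    rw [heq]
    exact hwi.sub hsum
  have hval : ∫ x, (1 - ∑ i, ind i x) * w x ∂μ = (∫ x, w x ∂μ) - ∑ i, ∫ x, ind i x * w x ∂μ := by
    rw [heq, integral_sub hwi hsum, integral_finsetSum _ fun i _ => hindi i]
  calc P * ∫ x, w x ∂μ ≤ P * (2 * ∫ x, (1 - ∑ i, ind i x) * w x ∂μ) := by
        refine mul_le_mul_of_nonneg_left ?_ hP0
        rw [hval]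
        linarith
    _ = 2 * ∫ x, P * ((1 - ∑ i, ind i x) * w x) ∂μ := by
        rw [integral_const_mul]
        ring
    _ ≤ 2 * ∫ x, (∏ i, F i x) * w x ∂μ :=
        mul_le_mul_of_nonneg_left (integral_mono (hmin.const_mul P) hFwi hpt) zero_le_two

/-- **A positive denominator moves out of a negative power in `ℝ≥0∞`.** For reals `F, A ≥ 0`, `D > 0`
and `r > 0`: `ofReal F · (ofReal (A / D))^{-r} = ofReal (F · D^r) · (ofReal A)^{-r}` — including the
junk-free boundary cases (`A = 0` gives `⊤` on both sides when `F > 0`, and `0` when `F = 0`).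
[folklore] -/
theorem ofReal_mul_ofReal_div_rpow_neg {F A D r : ℝ} (hF : 0 ≤ F) (hA : 0 ≤ A) (hD : 0 < D)
    (hr : 0 < r) :
    ENNReal.ofReal F * ENNReal.ofReal (A / D) ^ (-r) =
      ENNReal.ofReal (F * D ^ r) * ENNReal.ofReal A ^ (-r) := by
  rcases hA.eq_or_lt with hA0 | hA0
  · rw [← hA0, zero_div, ENNReal.ofReal_zero, ENNReal.zero_rpow_of_neg (neg_lt_zero.2 hr)]
    rcases hF.eq_or_lt with hF0 | hF0
    · rw [← hF0, zero_mul, ENNReal.ofReal_zero, zero_mul]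
    · rw [ENNReal.mul_top (ENNReal.ofReal_pos.2 hF0).ne',
        ENNReal.mul_top (ENNReal.ofReal_pos.2 (mul_pos hF0 (Real.rpow_pos_of_pos hD r))).ne']
  · rw [ENNReal.ofReal_rpow_of_pos (div_pos hA0 hD), ENNReal.ofReal_rpow_of_pos hA0,
      ← ENNReal.ofReal_mul hF, ← ENNReal.ofReal_mul (mul_nonneg hF (Real.rpow_nonneg hD.le _)),
      Real.div_rpow hA0.le hD.le, Real.rpow_neg hD.le, div_inv_eq_mul]
    congr 1
    ring

end Literature.MeasureTheory.Integral
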